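import Literature.MathematicalPhysics.QuantumFieldTheory.VillainAngleForm
import Literature.MathematicalPhysics.QuantumFieldTheory.CircleHaarAngle
import Mathlib.Probability.ProductMeasure
import HarnessLib

/-!
# The Villain `U(1)` theory on a cube as an integral over free link angles

Support file for the duality transformation of four-dimensional `U(1)` lattice gauge theory with
the Villain action (proof programme of the named fact
`Literature.MathematicalPhysics.QuantumFieldTheory.FrohlichSpencerU1PerimeterLawD4` and of its
corollary `Literature.Barriers.QuantumFields.AbelianDeconfinementD4`). We rewrite the tree's
free-boundary Villain expectation on the cube `B_n` (`zdVillainExpect β (halfOpenBox d n) F`, an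
integral against the normalised Haar measure of `U(1)^{E(ℤ^d)}` with density `∏_p φ_β(arg U_p)`)
in Fröhlich–Spencer's form (2.3): an integral over real link angles `θ ∈ (-π, π]^{E¹_n}` on the
free (non-comb) edges, the comb-tree angles being gauged to `0` (axial gauge,
`LatticeAxialGauge`), with weight `∏_p φ_β((dθ̃)_p)`:

* gauge invariance and box-locality of the Villain density and of the abelian Wilson loop
  (`zdVillainDensity_gaugeTransformZd`, `zdVillainDensity_ext_gaugeFixBox`,
  `zdWilsonLoop_u1_gaugeTransformZd`, `zdWilsonLoop_u1_ext_gaugeFixBox`, via Stokes);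
* Bochner versions of the `LatticeAxialGauge` reductions: `integral_zdHaar_eq_pi` (box-local
  integrands: `ℤ^d` → finite product Haar on `E_n`), `integral_pi_eq_integral_free` (Cor. 9.4:
  gauge-invariant integrands → product Haar on the free edges), and with `CircleHaarAngle`
  `integral_zdHaar_eq_integral_angle : ∫ F dg_∞ = (2π)^{-|E¹_n|} ∫_{(-π,π]^{E¹_n}} F(e^{iθ̃}) dθ`;
* `zdVillainExpect_eq_div` (`⟨F⟩_Λ = ∫ (∏φ_β) F dg_∞ / ∫ ∏φ_β dg_∞`) and the MAIN
  `zdVillainExpect_eq_angle_ratio`: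
  `⟨F⟩_{B_n} = ∫ F(e^{iθ̃}) ∏_p φ_β((dθ̃)_p) dθ / ∫ ∏_p φ_β((dθ̃)_p) dθ` over `(-π, π]^{E¹_n}`.

Everything is proved; no named fact is introduced.

## References

* J. Fröhlich, T. Spencer, Comm. Math. Phys. 83 (1982) 411–454, §2.2 (2.1)–(2.5).
  [FrohlichSpencerCMP1982]
* S. Chatterjee, arXiv:1602.01222, §9 (axial gauge fixing, Lemma 9.3 / Cor. 9.4). [arXiv160201222]
-/

noncomputable section

open MeasureTheory Measure Finset Function Set
open scoped ENNReal NNReal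
open Literature.Probability.LatticeModels
open Literature.MathematicalPhysics.QuantumLattice (u1Rep gaugeTransformZd plaquetteHolonomyZd_gaugeTransformZd)

namespace Literature.MathematicalPhysics.QuantumFieldTheory

/-- Sites of `ℤ^d` (the namespace-local `Site` is the torus one). -/
local notation "ZSite" => Literature.Probability.LatticeModels.Site

namespace VillainAngle

open AxialGauge LatticeForm CircleHaar

variable {d n : ℕ}

/-! ### Gauge invariance and box-locality of the integrands -/

/-- In an abelian gauge group the plaquette variables are gauge invariant. [folklore] -/
theorem plaquette_gaugeTransformZd_comm {G : Type*} [CommGroup G] (g : ZSite d → G)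
    (U : ZdGaugeConfig d G) (x : ZSite d) (i j : Fin d) :
    ZdGaugeConfig.plaquette (gaugeTransformZd g U) x i j = U.plaquette x i j := by
  have h := plaquetteHolonomyZd_gaugeTransformZd g U x i j
  rw [mul_inv_cancel_comm] at h
  exact h

/-- The Villain density is gauge invariant. [cite: FrohlichSpencerCMP1982, §2.2] -/
theorem zdVillainDensity_gaugeTransformZd (β : ℝ) (Λ : Finset (ZSite d)) (g : ZSite d → Circle)
    (U : ZdGaugeConfig d Circle) :
    zdVillainDensity β Λ (gaugeTransformZd g U) = zdVillainDensity β Λ U := by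
  unfold zdVillainDensity
  exact Finset.prod_congr rfl fun p _ => by rw [plaquette_gaugeTransformZd_comm]

/-- The Villain density of `B_n` only reads the edges of `B_n`. [folklore] -/
theorem zdVillainDensity_ext_restrict (β : ℝ) (U : ZdGaugeConfig d Circle) :
    zdVillainDensity β (halfOpenBox d n) (ext ((boxEdges d n).restrict U)) =
      zdVillainDensity β (halfOpenBox d n) U := by
  unfold zdVillainDensity
  refine Finset.prod_congr rfl fun p hp => ?_
  obtain ⟨h1, h2, h3, h4⟩ := edges_mem_boxEdges hp
  rw [plaquette_congr (ext_restrict_apply U h1) (ext_restrict_apply U h2) (ext_restrict_apply U h3)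
    (ext_restrict_apply U h4)]

/-- The Villain density of `B_n` is invariant under the axial gauge fixing of box configurations.
[folklore] -/
theorem zdVillainDensity_ext_gaugeFixBox (β : ℝ) (u : BoxCfg d Circle n) :
    zdVillainDensity β (halfOpenBox d n) (ext (gaugeFixBox u)) =
      zdVillainDensity β (halfOpenBox d n) (ext u) := by
  rw [gaugeFixBox, zdVillainDensity_ext_restrict, gaugeFix, zdVillainDensity_gaugeTransformZd]

/-- The abelian Wilson loop is gauge invariant (`i ≠ j`; Stokes). [folklore] -/
theorem zdWilsonLoop_u1_gaugeTransformZd (x : ZSite d) {i j : Fin d} (hij : i ≠ j) (R T : ℕ)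
    (g : ZSite d → Circle) (U : ZdGaugeConfig d Circle) :
    zdWilsonLoop u1Rep x i j R T (gaugeTransformZd g U) = zdWilsonLoop u1Rep x i j R T U := by
  unfold zdWilsonLoop
  rw [rectangle_eq_prod_plaquette _ x hij, rectangle_eq_prod_plaquette U x hij]
  simp_rw [plaquette_gaugeTransformZd_comm]

/-- The abelian Wilson loop of a rectangle whose sheet lies in `B_n` only reads the edges of `B_n`.
[folklore] -/
theorem zdWilsonLoop_u1_ext_restrict (x : ZSite d) {i j : Fin d} (hij : i ≠ j) {R T : ℕ}
    (hsub : rectPlaqs x i j R T ⊆ plaquettesIn (halfOpenBox d n)) (U : ZdGaugeConfig d Circle) :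
    zdWilsonLoop u1Rep x i j R T (ext ((boxEdges d n).restrict U)) = zdWilsonLoop u1Rep x i j R T U := by
  unfold zdWilsonLoop
  rw [rectangle_eq_prod_plaquette _ x hij, rectangle_eq_prod_plaquette U x hij]
  congr 4
  refine Finset.prod_congr rfl fun p hp => ?_
  obtain ⟨h1, h2, h3, h4⟩ := edges_mem_boxEdges (hsub hp)
  exact plaquette_congr (ext_restrict_apply U h1) (ext_restrict_apply U h2) (ext_restrict_apply U h3)
    (ext_restrict_apply U h4)

/-- The abelian Wilson loop of a rectangle in `B_n` is invariant under the axial gauge fixing.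
[folklore] -/
theorem zdWilsonLoop_u1_ext_gaugeFixBox (x : ZSite d) {i j : Fin d} (hij : i ≠ j) {R T : ℕ}
    (hsub : rectPlaqs x i j R T ⊆ plaquettesIn (halfOpenBox d n)) (u : BoxCfg d Circle n) :
    zdWilsonLoop u1Rep x i j R T (ext (gaugeFixBox u)) = zdWilsonLoop u1Rep x i j R T (ext u) := by
  rw [gaugeFixBox, zdWilsonLoop_u1_ext_restrict x hij hsub, gaugeFix, zdWilsonLoop_u1_gaugeTransformZd x hij]

/-! ### Bochner versions of the axial-gauge reductions -/

section General

variable {G : Type*} [Group G] [TopologicalSpace G] [IsTopologicalGroup G] [CompactSpace G]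
  [MeasurableSpace G] [BorelSpace G]

/-- **`ℤ^d`-integrals of box-local functions are integrals over the finite product Haar measure on
the edges of the box** (Bochner version of `AxialGauge.lintegral_zdHaar_eq_pi`). [folklore] -/
theorem integral_zdHaar_eq_pi (F : ZdGaugeConfig d G → ℝ) (hF : Measurable F)
    (hdep : ∀ U, F U = F (ext ((boxEdges d n).restrict U))) :
    ∫ U, F U ∂(zdHaar d G) = ∫ u, F (ext u) ∂(Measure.pi fun _ : ↥(boxEdges d n) => haarProbability G) := by
  calc ∫ U, F U ∂(zdHaar d G)
      = ∫ U, (F ∘ ext) ((boxEdges d n).restrict U) ∂(Measure.infinitePi fun _ : ZdEdge d => haarProbability G) :=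
        integral_congr_ae (Filter.Eventually.of_forall fun U => hdep U)
    _ = _ := integral_restrict_infinitePi (μ := fun _ : ZdEdge d => haarProbability G)
          ((hF.comp measurable_ext).stronglyMeasurable.aestronglyMeasurable)

variable [SecondCountableTopology G]

/-- **Cor. 9.4 for Bochner integrals (integration in the axial gauge)**: for a measurable real `Φ`
on `U(B_n)` invariant under the axial gauge fixing `U ↦ G_U · U`,
`∫_{U(B_n)} Φ dσ = ∫_{G^{E¹_n}} Φ(1 on E⁰_n, v on E¹_n) dσ^{E¹_n}(v)`. [cite: arXiv160201222, Cor. 9.4] -/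
theorem integral_pi_eq_integral_free (Φ : BoxCfg d G n → ℝ) (hΦ : Measurable Φ)
    (hinv : ∀ u, Φ (gaugeFixBox u) = Φ u) :
    ∫ u, Φ u ∂(Measure.pi fun _ : ↥(boxEdges d n) => haarProbability G) =
      ∫ v, Φ (ext₁ v) ∂(Measure.pi fun _ : {e : ↥(boxEdges d n) // ¬ IsComb e.1} => haarProbability G) := by
  have hm : AEStronglyMeasurable (Φ ∘ ext₁)
      ((Measure.pi fun _ : ↥(boxEdges d n) => haarProbability G).map freePart) := by
    rw [map_freePart_pi]
    exact (hΦ.comp measurable_ext₁).stronglyMeasurable.aestronglyMeasurable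
  calc ∫ u, Φ u ∂(Measure.pi fun _ : ↥(boxEdges d n) => haarProbability G)
      = ∫ u, (Φ ∘ ext₁) (freePart u) ∂(Measure.pi fun _ : ↥(boxEdges d n) => haarProbability G) :=
        integral_congr_ae (Filter.Eventually.of_forall fun u => by
          show Φ u = Φ (ext₁ (freePart u))
          rw [← gaugeFixBox_eq_ext₁_freePart, hinv])
    _ = ∫ v, (Φ ∘ ext₁) v ∂((Measure.pi fun _ : ↥(boxEdges d n) => haarProbability G).map freePart) :=
        (integral_map measurable_freePart.aemeasurable hm).symm
    _ = _ := by rw [map_freePart_pi]; rfl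

end General

/-- **The `U(1)` Haar integral of a box-local, gauge-invariant function as an integral over free
link angles**: `∫ F dg_∞ = (2π)^{-|E¹_n|} ∫_{(-π,π]^{E¹_n}} F(e^{iθ̃}) dθ`.
[cite: FrohlichSpencerCMP1982, §2.2 (2.1)–(2.3)] -/
theorem integral_zdHaar_eq_integral_angle (F : ZdGaugeConfig d Circle → ℝ) (hF : Measurable F)
    (hdep : ∀ U, F U = F (ext ((boxEdges d n).restrict U)))
    (hinv : ∀ u : BoxCfg d Circle n, F (ext (gaugeFixBox u)) = F (ext u)) :
    ∫ U, F U ∂(zdHaar d Circle) =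
      ((2 * Real.pi)⁻¹) ^ Fintype.card {e : ↥(boxEdges d n) // ¬ IsComb e.1} •
        ∫ θ in Set.pi univ (fun _ => Ioc (-Real.pi) Real.pi), F (cfgOfAngle (d := d) (n := n) θ) := by
  rw [integral_zdHaar_eq_pi F hF hdep, integral_pi_eq_integral_free (fun u => F (ext u))
    (hF.comp measurable_ext) hinv, integral_pi_haarProbability_circle (fun v => F (ext (ext₁ v)))
    ((hF.comp (measurable_ext.comp measurable_ext₁)).stronglyMeasurable.aestronglyMeasurable)]
  congr 1
  refine integral_congr_ae (Filter.Eventually.of_forall fun θ => ?_)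
  simp only [cfgOfAngle_eq_ext_ext₁]

/-! ### The Villain expectation as a ratio of angle integrals -/

/-- `⟨F⟩_Λ = ∫ (∏ φ_β) F dg_∞ / ∫ ∏ φ_β dg_∞` (`β > 0`). [cite: FrohlichSpencerCMP1982, §2.2 (2.3)] -/
theorem zdVillainExpect_eq_div {β : ℝ} (hβ : 0 < β) (Λ : Finset (ZSite d))
    (F : ZdGaugeConfig d Circle → ℝ) :
    zdVillainExpect β Λ F =
      (∫ U, zdVillainDensity β Λ U * F U ∂(zdHaar d Circle)) /
        ∫ U, zdVillainDensity β Λ U ∂(zdHaar d Circle) := by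
  have h1 := zdVillainExpect_eq_mul_integral (d := d) hβ Λ F
  have h2 := zdVillainExpect_eq_mul_integral (d := d) hβ Λ fun _ => (1 : ℝ)
  rw [zdVillainExpect_one hβ] at h2
  simp only [mul_one] at h2
  have hZ : ∫ U, zdVillainDensity β Λ U ∂(zdHaar d Circle) ≠ 0 := by
    intro h; rw [h, mul_zero] at h2; exact one_ne_zero h2
  rw [h1, eq_div_iff hZ, mul_assoc, mul_comm (∫ U, zdVillainDensity β Λ U * F U ∂zdHaar d Circle),
    ← mul_assoc, ← h2, one_mul]

/-- **The Villain expectation on the cube as a ratio of angle integrals** (FS82 (2.3) in the axial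
gauge): for `β > 0` and a measurable, box-local, gauge-fixing-invariant real observable `F`,
`⟨F⟩_{B_n} = ∫ F(e^{iθ̃}) ∏_{p ⊂ B_n} φ_β((dθ̃)_p) dθ / ∫ ∏_{p ⊂ B_n} φ_β((dθ̃)_p) dθ`, both integrals
over `θ ∈ (-π, π]^{E¹_n}`. [cite: FrohlichSpencerCMP1982, §2.2 (2.3)] -/
theorem zdVillainExpect_eq_angle_ratio {β : ℝ} (hβ : 0 < β) (F : ZdGaugeConfig d Circle → ℝ)
    (hF : Measurable F) (hdep : ∀ U, F U = F (ext ((boxEdges d n).restrict U)))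
    (hinv : ∀ u : BoxCfg d Circle n, F (ext (gaugeFixBox u)) = F (ext u)) :
    zdVillainExpect β (halfOpenBox d n) F =
      (∫ θ in Set.pi univ (fun _ => Ioc (-Real.pi) Real.pi),
          (∏ p ∈ plaquettesIn (halfOpenBox d n),
              villainKernel β (d₁ (extAngle (d := d) (n := n) θ) p.1 p.2.1 p.2.2)) * F (cfgOfAngle θ)) /
        ∫ θ in Set.pi univ (fun _ => Ioc (-Real.pi) Real.pi),
          ∏ p ∈ plaquettesIn (halfOpenBox d n),
            villainKernel β (d₁ (extAngle (d := d) (n := n) θ) p.1 p.2.1 p.2.2) := by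
  have hDm : Measurable (zdVillainDensity (d := d) β (halfOpenBox d n)) :=
    (continuous_zdVillainDensity hβ _).measurable
  have hc : ((2 * Real.pi)⁻¹) ^ Fintype.card {e : ↥(boxEdges d n) // ¬ IsComb e.1} ≠ 0 :=
    pow_ne_zero _ (inv_ne_zero (by positivity))
  rw [zdVillainExpect_eq_div hβ,
    integral_zdHaar_eq_integral_angle (fun U => zdVillainDensity β _ U * F U) (hDm.mul hF)
      (fun U => by rw [zdVillainDensity_ext_restrict, ← hdep])
      (fun u => by rw [zdVillainDensity_ext_gaugeFixBox, hinv]),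
    integral_zdHaar_eq_integral_angle (zdVillainDensity β _) hDm
      (fun U => (zdVillainDensity_ext_restrict β U).symm) (zdVillainDensity_ext_gaugeFixBox β),
    smul_eq_mul, smul_eq_mul, mul_div_mul_left _ _ hc]
  simp only [zdVillainDensity_cfgOfAngle]

end VillainAngle

end Literature.MathematicalPhysics.QuantumFieldTheory
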